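import Summits.CriticalPhenomena.SAWScalingLimit.Theses.SAWCompassLattice
import Summits.CriticalPhenomena.SAWScalingLimit.Theorems.ObservableToSLE.Negative.CompactContainer
import Summits.CriticalPhenomena.SAWScalingLimit.Theorems.SAWCompassLatticeCompassSLEYbSubseqLimitChordal
import Summits.CriticalPhenomena.SAWScalingLimit.Theorems.SAWCompassLatticeCompassSLEYbTightOfTraversalBound
import Summits.CriticalPhenomena.SAWScalingLimit.Theorems.SAWCompassLatticeSurfaceUniversalityNonVacuity

/-!
# A compact container for the curve classes of Glazman–Manolescu's `π/2` Yang–Baxter walks at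
# meshes bounded below (crux `CompassSLE`, stmt-CriticalPhenomena-6965, line `registered`, lead c2;
# support file for the honesty certificate "crux ⇒ T1" of `…CompassSLEYbTightNecessity.lean`)

Square-tiling mirror of `ObservableToSLE/Negative/CompactContainer.lean` (`δℍ`) and
`SubseqIdentification/Negative/CompactContainerZd.lean` (`δℤ²`): for meshes in a compact interval
`[lo, hi] ⊆ (0, ∞)` ALL curve classes `γ.curve (π/2) δ` of all Yang–Baxter walks
`γ : YangBaxterSAW (π/2) Ω δ a b` of a bounded domain `Ω` between DISTINCT mid-edges `a ≠ b` lie in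
ONE compact subset of `CurveClass ℂ` (`exists_isCompact_forall_ybCurve_mem`):

* the faces of `meshFaces (π/2) Ω δ`, `δ ≥ lo`, lie in one finite set of faces
  (`exists_finite_superset_meshFaces`, from `Surface.meshFaces_rightAngles_finite` applied to the ball
  `B(0, R/lo)` at mesh `1`), hence their sides in one finite set of mid-edges;
* every mid-edge crossed by a walk with `a ≠ b` is a side of a face of the domain
  (`exists_side_eq_of_mem_mids`: `YBWalk.mem_mids_cases` away from the head, and the first arc
  `exists_mids_eq_cons_cons` + `arc_mem` + `eq_faces_of_commonFace` for the head `a`);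
* a walk crosses each edge once (`YBWalk.nodup`), and nodup lists over a finite set are finitely many
  (`Literature.Probability.Percolation.finite_setOf_nodup_subset`);
* the class of the rescaled polyline of a FIXED list of mid-edges moves Lipschitz-continuously with
  the mesh (`dist_mk_polyline_le`, `continuous_mk_polyline`, from the generic `dist_polyline_map_le`).

No named fact is used. Reference for the model: A. Glazman, I. Manolescu, Ann. Inst. Henri Poincaré
Probab. Stat. 56 (2020), §1 [GlazmanManolescu2019].
-/

noncomputable section

namespace Summit.CriticalPhenomena.SAWScalingLimit.Theorems.SAWCompassLatticeCompassSLE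

open MeasureTheory Filter Topology Set Metric
open scoped NNReal ENNReal
open Literature.Probability.RandomPlanarGeometry
open Literature.Probability.RandomPlanarGeometry.SAW.YangBaxter
open Summit.CriticalPhenomena.SAWScalingLimit.Theses
open Literature.Probability.LatticeModels (polyline)

namespace YbCompactContainer

/-! ### Rescaled mid-edge polylines: continuity in the mesh -/

/-- The curve of a Yang–Baxter walk is the class of the rescaled polyline through the midpoints of
the mid-edges it crosses (definitional). -/
theorem curve_eq_mk_polyline {Θ : ℤ → ℝ} {Δ : Set Face} {δ : ℝ} {a b : MidEdge} (γ : YBWalk Δ a b) :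
    γ.curve Θ δ = CurveClass.mk ⟨polyline (γ.mids.map fun e => (δ : ℂ) * planeMidpoint Θ e)⟩ :=
  rfl

/-- The rescaled polyline of a fixed list of mid-edges moves Lipschitz-continuously with the mesh. -/
theorem dist_mk_polyline_le (Θ : ℤ → ℝ) (δ δ' : ℝ) (l : List MidEdge) :
    dist (CurveClass.mk ⟨polyline (l.map fun e => (δ : ℂ) * planeMidpoint Θ e)⟩)
        (CurveClass.mk ⟨polyline (l.map fun e => (δ' : ℂ) * planeMidpoint Θ e)⟩) ≤
      dist δ δ' * ∑ v ∈ l.toFinset, ‖planeMidpoint Θ v‖ := by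
  -- adapted from `ObservableToSLE.Negative.dist_mk_polyline_le` (hexCenter ↦ planeMidpoint)
  rw [CurveClass.dist_mk_mk]
  refine (Curve.dist_le_dist_toContinuousMap _ _).trans ?_
  refine ObservableToSLE.Negative.dist_polyline_map_le _ _ (by positivity) l fun v hv => ?_
  rw [dist_eq_norm, ← sub_mul, norm_mul, ← dist_eq_norm, Complex.dist_eq, ← Complex.ofReal_sub,
    Complex.norm_real, Real.norm_eq_abs, ← Real.dist_eq]
  refine mul_le_mul_of_nonneg_left ?_ dist_nonneg
  exact Finset.single_le_sum (f := fun v => ‖planeMidpoint Θ v‖) (fun _ _ => norm_nonneg _)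
    (List.mem_toFinset.2 hv)

/-- Continuity of the class of the rescaled polyline of a fixed list of mid-edges in the mesh. -/
theorem continuous_mk_polyline (Θ : ℤ → ℝ) (l : List MidEdge) :
    Continuous fun δ : ℝ =>
      CurveClass.mk ⟨polyline (l.map fun e => (δ : ℂ) * planeMidpoint Θ e)⟩ := by
  set M : ℝ := ∑ v ∈ l.toFinset, ‖planeMidpoint Θ v‖ with hM
  have hM0 : 0 ≤ M := Finset.sum_nonneg fun _ _ => norm_nonneg _
  refine Metric.continuous_iff.2 fun δ ε hε => ⟨ε / (M + 1), by positivity, fun δ' hδ' => ?_⟩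
  calc dist (CurveClass.mk ⟨polyline (l.map fun e => (δ' : ℂ) * planeMidpoint Θ e)⟩)
        (CurveClass.mk ⟨polyline (l.map fun e => (δ : ℂ) * planeMidpoint Θ e)⟩)
        ≤ dist δ' δ * M := dist_mk_polyline_le Θ δ' δ l
    _ ≤ ε / (M + 1) * M := mul_le_mul_of_nonneg_right hδ'.le hM0
    _ < ε := by
        rw [div_mul_eq_mul_div, div_lt_iff₀ (by positivity)]
        nlinarith

/-! ### Finitely many faces and mid-edges for meshes bounded below -/

/-- For meshes `δ ≥ lo > 0` the faces of the discretisations `Ω_δ` of a bounded domain on the square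
tiling lie in ONE finite set of faces (those of the ball `B(0, R/lo)` at mesh `1`, `Ω ⊆ B(0, R)`). -/
theorem exists_finite_superset_meshFaces {Ω : Set ℂ} (hΩ : Bornology.IsBounded Ω) {lo : ℝ}
    (hlo : 0 < lo) :
    ∃ F : Set Face, F.Finite ∧ ∀ δ, lo ≤ δ → meshFaces (fun (_ : ℤ) => Real.pi / 2) Ω δ ⊆ F := by
  obtain ⟨R, hR⟩ := hΩ.subset_ball 0
  refine ⟨meshFaces SAW.rightAngles (Metric.ball (0 : ℂ) (R / lo)) 1,
    Cruxes.HexTransfer.Sketch.Surface.meshFaces_rightAngles_finite Metric.isBounded_ball one_pos,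
    fun δ hδ f hf z hz => ?_⟩
  have hδ0 : 0 < δ := hlo.trans_le hδ
  have h := hR (hf z hz)
  rw [Metric.mem_ball, dist_zero_right, norm_mul, Complex.norm_real, Real.norm_eq_abs,
    abs_of_pos hδ0] at h
  show ((1 : ℝ) : ℂ) * z ∈ Metric.ball (0 : ℂ) (R / lo)
  rw [Complex.ofReal_one, one_mul, Metric.mem_ball, dist_zero_right, lt_div_iff₀ hlo]
  calc ‖z‖ * lo ≤ ‖z‖ * δ := mul_le_mul_of_nonneg_left hδ (norm_nonneg _)
    _ = δ * ‖z‖ := mul_comm _ _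
    _ < R := h

/-- Every mid-edge crossed by a Yang–Baxter walk between DISTINCT mid-edges is a side of a face of the
domain: away from the head this is `YBWalk.mem_mids_cases`; the head `a` is the start of the first arc
(`exists_mids_eq_cons_cons`), drawn in a face of the domain bordering `a`. -/
theorem exists_side_eq_of_mem_mids {Δ : Set Face} {a b : MidEdge} (γ : YBWalk Δ a b) (hab : a ≠ b)
    {e : MidEdge} (he : e ∈ γ.mids) : ∃ f ∈ Δ, ∃ s : Side, f.side s = e := by
  rcases γ.mem_mids_cases he with hea | h
  · obtain ⟨e', l, hm⟩ := exists_mids_eq_cons_cons γ hab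
    have harc : (a, e') ∈ arcsOf γ.mids := by
      rw [hm]
      simp [arcsOf]
    obtain ⟨f, hfΔ, hf⟩ := γ.arc_mem _ harc
    obtain ⟨h1, -⟩ := eq_faces_of_commonFace hf
    obtain ⟨s, hs⟩ := TightOfTraversalBound.exists_eq_side_of_eq_faces h1
    refine ⟨f, hfΔ, s, ?_⟩
    rw [hea]
    exact hs.symm
  · exact h

end YbCompactContainer

open YbCompactContainer in
/-- **COMPACT CONTAINER for the `π/2` Yang–Baxter walk.** For meshes in a compact interval
`[lo, hi] ⊆ (0, ∞)` all curve classes `γ.curve (π/2) δ` of all walks `γ : YangBaxterSAW (π/2) Ω δ a b`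
of a bounded domain `Ω` between distinct mid-edges `a ≠ b` lie in ONE compact subset of
`CurveClass ℂ`: finitely many combinatorial supports (nodup lists of sides of the finitely many faces,
`exists_finite_superset_meshFaces`, `exists_side_eq_of_mem_mids`, `finite_setOf_nodup_subset`), each
rescaled polyline moving continuously with the mesh (`continuous_mk_polyline`). Port of
`ObservableToSLE.Negative.exists_isCompact_forall_curve_mem`. Registered sub-goal stub
`exists_isCompact_forall_ybCurve_mem` of the crux item (support for the certificate "crux ⇒ T1"). -/
theorem exists_isCompact_forall_ybCurve_mem :
    ∀ (Ω : Set ℂ), Bornology.IsBounded Ω → ∀ (lo hi : ℝ), 0 < lo →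
      ∃ C : Set (CurveClass ℂ), IsCompact C ∧ ∀ δ ∈ Set.Icc lo hi, ∀ (a b : MidEdge), a ≠ b →
        ∀ γ : YangBaxterSAW (fun (_ : ℤ) => Real.pi / 2) Ω δ a b,
          γ.curve (fun (_ : ℤ) => Real.pi / 2) δ ∈ C := by
  -- adapted from `ObservableToSLE.Negative.exists_isCompact_forall_curve_mem`
  intro Ω hΩ lo hi hlo
  obtain ⟨F, hF, hsub⟩ := exists_finite_superset_meshFaces hΩ hlo
  set S : Set MidEdge := ⋃ f ∈ F, Set.range f.side with hS
  have hSfin : S.Finite := hF.biUnion fun _ _ => Set.finite_range _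
  set L : Set (List MidEdge) := {l | l.Nodup ∧ ∀ x ∈ l, x ∈ S} with hL
  have hLfin : L.Finite := Literature.Probability.Percolation.finite_setOf_nodup_subset hSfin
  refine ⟨⋃ l ∈ L, (fun δ : ℝ => CurveClass.mk
      ⟨polyline (l.map fun e => (δ : ℂ) * planeMidpoint (fun (_ : ℤ) => Real.pi / 2) e)⟩) ''
        Set.Icc lo hi,
    hLfin.isCompact_biUnion fun l _ => isCompact_Icc.image (continuous_mk_polyline _ l), ?_⟩
  intro δ hδ a b hab γ
  rw [curve_eq_mk_polyline]
  refine Set.mem_biUnion (x := γ.mids) ⟨γ.nodup, fun x hx => ?_⟩ ⟨δ, hδ, rfl⟩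
  obtain ⟨f, hf, s, rfl⟩ := exists_side_eq_of_mem_mids γ hab hx
  exact Set.mem_biUnion (hsub δ hδ.1 hf) ⟨s, rfl⟩

end Summit.CriticalPhenomena.SAWScalingLimit.Theorems.SAWCompassLatticeCompassSLE

end
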